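import Summits.BirchSwinnertonDyer.BirchSwinnertonDyer.Theses.PrintX9
import Summits.BirchSwinnertonDyer.BirchSwinnertonDyer.Theorems.PrintX9HowardContainmentPinnedOfFlachLeafIntended
import HarnessLib

/-!
# PrintX9 — entry for the glue item `HowardContainmentLightFramePinnedOfFlachLeavesIntended` (pen plan g16 r8″ round, 2026-08-29)

One line over this seat's DISPLAY-PROP141″-X9 theorem
`PrintX9OfFlachLeafIntended.howardContainmentLightFramePinned_of_prop141Intended_kolyvaginSystem_cgs :
prop141_casselsTate_skewPairing_atLevel_printIntended → CGLSHeegnerKolyvaginSystem → CGSHowardDivisibilityPLocalized → HowardContainmentLightFramePinned`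
(p723343): the route's glue text reads the first binder through the by-name leaf `HowardFlachSkewPairingAtLevelIntended :=
Howard2004.prop141_casselsTate_skewPairing_atLevel_printIntended` (C45.1″, REF-177), which unfolds definitionally. Cell `pub/bsd-print-x9`, seat
`bsd-line-x9-p1` LEAD g10. Glue only: CONDITIONAL on the cite-only print leaves the route lists (C45.1″, F-411, CGS 6.5.2, …); no summit statement is
proved; BSD is NOT proved by this.
-/

set_option linter.dupNamespace false
set_option autoImplicit false

namespace Summit.BirchSwinnertonDyer.BirchSwinnertonDyer.Theorems.PrintX9FlachLeavesIntendedEntry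

open Summit.BirchSwinnertonDyer.BirchSwinnertonDyer.Theses.PrintX9

/-- **The glue item `HowardContainmentLightFramePinnedOfFlachLeavesIntended` BY NAME**: Howard Prop. 1.4.1 / Thm. 1.4.2 print-as-intended
(C45.1″) ⟹ CGLS Thm. 4.1.1 (KS form) ⟹ CGS Thm. 6.5.2 ⟹ `HowardContainmentLightFramePinned`, by this seat's
`PrintX9OfFlachLeafIntended.howardContainmentLightFramePinned_of_prop141Intended_kolyvaginSystem_cgs` (Howard Thm. 1.6.1-as-intended being the
kernel theorem of the cell's G87 engine). [cite: Howard2004HeegnerKolyvagin, Prop. 1.4.1, Thm. 1.4.2, Thm. 1.6.1]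
[cite: CastellaGrossiLeeSkinner2022, Thm. 4.1.1, Rem. 4.1.4] [cite: CastellaGrossiSkinner2025, Thm. 6.5.2] -/
theorem howardContainmentLightFramePinnedOfFlachLeavesIntended_holds : HowardContainmentLightFramePinnedOfFlachLeavesIntended :=
  fun h141 hK hCGS =>
    Summit.BirchSwinnertonDyer.BirchSwinnertonDyer.Theorems.PrintX9OfFlachLeafIntended.howardContainmentLightFramePinned_of_prop141Intended_kolyvaginSystem_cgs
      h141 hK hCGS

end Summit.BirchSwinnertonDyer.BirchSwinnertonDyer.Theorems.PrintX9FlachLeavesIntendedEntry
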